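import Summits.QuantumFields.YangMills.Theorems.BalabanUVNodesN06HHLegAtPinsPhys
import Literature.MathematicalPhysics.QuantumFieldTheory.Balaban1983to89.B9OpsRTransportSectD

/-!
# BalabanUVNodes ∕ N06 ([B9], `Dag.B9_main`) — CASCADE-R STEP 3: THE R-GENERIC TWIN of `N06HHLegAtPinsPhys.hLHH_of_pins` (rows 20–21's `LettersHHZ` letter `hLHH` + the `DMZ` lift),
# re-typed over the CLASS-PARAMETRIC member background `bg9YR 𝔸 G R₁ R₂` (objects AND premises), the Y-class content ONE displayed hypothesis

Track A of `YM-PLAN.md` (cell `pub-ymgap`, D-0062), node **N06** = [Balaban1985BackgroundPropagators] Thms 3.1–3.15; seat `pub-ymgap-dag-n06-d` (gen 13).  WHY: node00-def-Y g23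
RULING-2 (I.39588), road (α1); census I.39391 marks `hLHH_of_pins` «`bg9Y`-PINNED ✗, c-GENERIC».  Its content is dag-n06-w5's `B9LettersHHZWholeAtPins.lettersHHZ_pins` (an
Ops-TYPED Y-face reading the (3.35) class of `U`) + `B9LettersZSchemasMono.letters313DMZ_mono` (B-generic) — consumed UNCHANGED at the fieldwise re-typings `ops312RY (𝔬12 x)`,
`holderProbesRY (𝔭A x)` (node00-def-Y's `B9OpsRTransport` p648903, road (B)), the G₀-layer input carried in by `thm33G0Dir_iff`, the `LettersHHZ` output carried back by node00-def-Y's `lettersHHZ_iff`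
(`B9OpsRTransportSectD`, added on this seat's ask, bus 16:52Z); per RULING-2 (c) the class read is ONE displayed hypothesis `hY335` (Y-closer: `id`; P-closer: dag-n06-j's bridge at `c35 := c35B ℓ`).
★★ `hLHH_of_pinsR` — `hLHH_of_pins` with `bg9Y … x ↦ bg9YR … R₁ R₂ x` in every object and premise, `+ hY335`; same closed witnesses `MQ`, `Bq⋆`.
HONEST FRAMING.  Mechanical re-typing + transport; the estimate is dag-n06-w5's kernel-checked theorem; nothing of [B9] asserted beyond it; COUNT-NEUTRAL; N06 NOT discharged;
K1⁹ NOT closed; one finite 𝕋⁴ programme at fixed `ε` — NOT continuum ∕ OS ∕ mass gap ∕ Clay.  0 `def`, 0 `sorry`.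
-/

noncomputable section

namespace Summit.QuantumFields.YangMills.BalabanUVNodes.N06HHLegAtPinsPhysR

open Literature.MathematicalPhysics.QuantumFieldTheory.Balaban1983to89
open Literature.MathematicalPhysics.QuantumFieldTheory.Balaban1983to89.Node00 (FBondY IBondY parBY)
open Literature.MathematicalPhysics.QuantumFieldTheory.Balaban1983to89.B9Thm34Ext (toB6)
open Literature.MathematicalPhysics.QuantumFieldTheory.Balaban1983to89.B11SectG (HasMaj BlockNorm RowSum)
open Literature.MathematicalPhysics.QuantumFieldTheory.Balaban1983to89.B9SectDSup (weightNorm)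
open Literature.MathematicalPhysics.QuantumFieldTheory.Balaban1983to89.B9RWSums343Holder (HolderProbes)
open Literature.MathematicalPhysics.QuantumFieldTheory.Balaban1983to89.B9Thm312WholeDir (Thm33G0Dir)
open Literature.MathematicalPhysics.QuantumFieldTheory.Balaban1983to89.B9Thm312WholeHZ (LettersHHZ)
open Literature.MathematicalPhysics.QuantumFieldTheory.Balaban1983to89.B9CoReadingCoords (XBK blkBK)
open Literature.MathematicalPhysics.QuantumFieldTheory.Balaban1983to89.B9CoReadingCoordsS (XSK)
open Literature.MathematicalPhysics.QuantumFieldTheory.Balaban1983to89.B9CoReadingCoordsH (XHK blkHK)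
open Literature.MathematicalPhysics.QuantumFieldTheory.Balaban1983to89.B9CoReadingCoordsTranspose (TrIdx trBasis)
open Literature.MathematicalPhysics.QuantumFieldTheory.Balaban1983to89.B9LettersHHZWholeAtPins (lettersHHZ_pins)
open Literature.MathematicalPhysics.QuantumFieldTheory.Balaban1983to89.B9LettersZSchemasMono (letters313DMZ_mono)
open Literature.MathematicalPhysics.QuantumFieldTheory.Balaban1983to89.B9Thm313WholeDirZ (Letters313DMZ)
open Literature.MathematicalPhysics.QuantumFieldTheory.Balaban1983to89.B9GeoLemma21KLevelV1 (geo9Y_dist_triangle geo9Y_dist_comm)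
open Literature.MathematicalPhysics.QuantumFieldTheory.Balaban1983to89.B9GeoNormsKLevelV1 (geo9K_dist_nonneg)
open Literature.MathematicalPhysics.QuantumFieldTheory.Balaban1983to89.B9LettersHZAtOne (plateau_pos)
open Literature.MathematicalPhysics.QuantumFieldTheory.Balaban1983to89.B9PinMembersKLevelV1 (MemberY geo9Y bg9Y)
open Literature.MathematicalPhysics.QuantumFieldTheory.Balaban1983to89.B9BackgroundsKLevelV1R (RegFamY bg9YR)
open Literature.MathematicalPhysics.QuantumFieldTheory.Balaban1983to89.B9OpsRTransport (ops312RY holderProbesRY)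
open Literature.MathematicalPhysics.QuantumFieldTheory.Balaban1983to89.B9OpsRTransportSectD (thm33G0Dir_iff lettersHHZ_iff)
open Literature.MathematicalPhysics.QuantumFieldTheory.Balaban1983to89.B9GeoLemma21KLevelV1 (geo9Y_len_pos rowSum261_geo9Y)
open Literature.MathematicalPhysics.QuantumFieldTheory.Balaban1983to89.Node00.OpsYSectDCoords (QscoKH)
open Literature.MathematicalPhysics.QuantumFieldTheory.Balaban1983to89.B7Prop2SpecialUnitary (specialUnitaryUnits)
open Literature.MathematicalPhysics.QuantumFieldTheory.Balaban1983to89.B6GlobalChartV1 (blkV1)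
open Literature.MathematicalPhysics.QuantumFieldTheory.Balaban1983to89.B6Ineq2142KLevelV1 (β lvl)
open Literature.MathematicalPhysics.QuantumFieldTheory.Balaban1983to89.B6Geom246MultiLevelTorus (geomT)
open scoped Matrix.Norms.L2Operator

variable {d ℓ : ℕ} {hd : 1 ≤ d + 1} {hL : Odd (ℓ + 1) ∧ 1 < ℓ + 1} {b₀ b₁ : ℝ} {Mstar : ℕ} {N : ℕ} [NeZero N]
variable [∀ x : MemberY d ℓ hd hL b₀ b₁ Mstar, Fintype (geo9Y x).Site]

/-- ★★ **`hLHH` AT THE MEMBERS, R-GENERIC** (module docstring).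
[cite: Balaban1985BackgroundPropagators, (3.132)–(3.133) p.422 + Thm 3.3 (3.43) p.398 + (3.35)–(3.36) p.396 + Thm 3.13 p.426; Balaban1984PropagatorsII, (2.51)–(2.56) pp.232–233 + Lemma 2.1 (2.61) p.234] -/
theorem hLHH_of_pinsR {R₁ R₂ : RegFamY d ℓ hd hL b₀ b₁ Mstar (Matrix (Fin N) (Fin N) ℂ)} {PX PY : MemberY d ℓ hd hL b₀ b₁ Mstar → Type} [∀ x, Fintype (PX x)] [∀ x, Fintype (PY x)]
    (H : MemberY d ℓ hd hL b₀ b₁ Mstar → Prop)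
    (bI : ∀ x : MemberY d ℓ hd hL b₀ b₁ Mstar, FBondY x.toKIdx → IBondY x.toKIdx)
    (hβ1 : ∀ (x : MemberY d ℓ hd hL b₀ b₁ Mstar) (f : FBondY x.toKIdx), (geomT x.D).dist (β x.hN x.D x.hk (bI x f)) (blkV1 x.hN x.D f) ≤ 1)
    (𝔭A : ∀ x : MemberY d ℓ hd hL b₀ b₁ Mstar, HolderProbes (geo9Y x) (bg9YR (Matrix (Fin N) (Fin N) ℂ) (specialUnitaryUnits (Fin N)) R₁ R₂ x) (XBK (TrIdx N) x.toKIdx)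
      (XBK (TrIdx N) x.toKIdx) (PX x) (PY x))
    (Dd Dds : ∀ x : MemberY d ℓ hd hL b₀ b₁ Mstar, (bg9YR (Matrix (Fin N) (Fin N) ℂ) (specialUnitaryUnits (Fin N)) R₁ R₂ x).Cfg → Fin (d + 1) →
      Module.End ℝ (XBK (TrIdx N) x.toKIdx → ℝ))
    (bHXA : ∀ x : MemberY d ℓ hd hL b₀ b₁ Mstar, ℝ → BlockNorm (toB6 (geo9Y x) 1 (H x)) ((XBK (TrIdx N) x.toKIdx) → ℝ))
    (𝔬12 : ∀ x : MemberY d ℓ hd hL b₀ b₁ Mstar, B9Thm312Whole.Ops (geo9Y x) (bg9YR (Matrix (Fin N) (Fin N) ℂ) (specialUnitaryUnits (Fin N)) R₁ R₂ x)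
      (XBK (TrIdx N) x.toKIdx) (XBK (TrIdx N) x.toKIdx) (XHK (TrIdx N) x.toKIdx) (XSK (TrIdx N) x.toKIdx))
    (hblk12 : ∀ x : MemberY d ℓ hd hL b₀ b₁ Mstar, (𝔬12 x).blk = blkBK x.toKIdx (bI x))
    (hblkZ12 : ∀ x : MemberY d ℓ hd hL b₀ b₁ Mstar, (𝔬12 x).blkZ = blkHK x.toKIdx)
    (hQsco12 : ∀ (x : MemberY d ℓ hd hL b₀ b₁ Mstar) (U : (bg9YR (Matrix (Fin N) (Fin N) ℂ) (specialUnitaryUnits (Fin N)) R₁ R₂ x).Cfg),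
      (𝔬12 x).Qstar U = QscoKH x.toKIdx (trBasis N) (bg9YR (Matrix (Fin N) (Fin N) ℂ) (specialUnitaryUnits (Fin N)) R₁ R₂ x) (fun U => U) (parBY x.toKIdx) U)
    (bH13 : ∀ x : MemberY d ℓ hd hL b₀ b₁ Mstar, BlockNorm (toB6 (geo9Y x) 1 (H x)) (XSK (TrIdx N) x.toKIdx → ℝ)) (Bq12 : ℝ → ℝ) (hBq12 : ∀ β, 0 ≤ Bq12 β)
    {B12₀ δ12₀ B12₃ δ12₃ M₀ a₀ c35 : ℝ} {Bh12 Bi12 : ℝ → ℝ} {Bi2₁₂ : ℝ → ℝ → ℝ}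
    (hB12₃ : 0 ≤ B12₃) (hBh12 : ∀ β, 0 ≤ β → β < 1 → 0 ≤ Bh12 β) (hδ12₃ : 0 ≤ δ12₃) (hδ₃₀ : δ12₃ ≤ δ12₀)
    -- RULING-2 (c): dag-n06-w5's `lettersHHZ_pins` reads the (3.35) class of `U` — ONE displayed class-content hypothesis: the R-class lies in MODULE 3's class at the same constant
    (hY335 : ∀ (x : MemberY d ℓ hd hL b₀ b₁ Mstar) (α₀ : ℝ) (U : (bg9YR (Matrix (Fin N) (Fin N) ℂ) (specialUnitaryUnits (Fin N)) R₁ R₂ x).Cfg), (bg9YR (Matrix (Fin N) (Fin N) ℂ) (specialUnitaryUnits (Fin N)) R₁ R₂ x).Reg335 c35 α₀ U → (bg9Y (Matrix (Fin N) (Fin N) ℂ) (specialUnitaryUnits (Fin N)) x).Reg335 c35 α₀ U)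
    (h33 : ∀ x : MemberY d ℓ hd hL b₀ b₁ Mstar, M₀ ≤ (geo9Y x).M → ∀ α₀ : ℝ, 0 < α₀ → (geo9Y x).M * α₀ ≤ a₀ →
      ∀ U : (bg9YR (Matrix (Fin N) (Fin N) ℂ) (specialUnitaryUnits (Fin N)) R₁ R₂ x).Cfg,
        (bg9YR (Matrix (Fin N) (Fin N) ℂ) (specialUnitaryUnits (Fin N)) R₁ R₂ x).Reg335 c35 α₀ U →
        (bg9YR (Matrix (Fin N) (Fin N) ℂ) (specialUnitaryUnits (Fin N)) R₁ R₂ x).Reg336 c35 α₀ U →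
          Thm33G0Dir (𝔬12 x) (𝔭A x) (Dd x) (Dds x) 1 (H x) (bHXA x) B12₀ Bh12 Bi12 Bi2₁₂ δ12₀ U) :
    ∃ (MQ : ℝ) (Bq : ℝ → ℝ), (∀ β, 0 ≤ Bq β) ∧
      (∀ x : MemberY d ℓ hd hL b₀ b₁ Mstar, MQ ≤ (geo9Y x).M → ∀ α₀ : ℝ, 0 < α₀ → (geo9Y x).M * α₀ ≤ a₀ →
        ∀ U : (bg9YR (Matrix (Fin N) (Fin N) ℂ) (specialUnitaryUnits (Fin N)) R₁ R₂ x).Cfg,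
          (bg9YR (Matrix (Fin N) (Fin N) ℂ) (specialUnitaryUnits (Fin N)) R₁ R₂ x).Reg335 c35 α₀ U →
          (bg9YR (Matrix (Fin N) (Fin N) ℂ) (specialUnitaryUnits (Fin N)) R₁ R₂ x).Reg336 c35 α₀ U →
            LettersHHZ (𝔬12 x) (𝔭A x) 1 (H x) (fun y => (geo9Y_len_pos x y).le)
              (weightNorm (BlockNorm.ofBlocks (toB6 (geo9Y x) 1 (H x)) (𝔬12 x).blkZ) (fun y => ((((ℓ + 1 : ℕ) : ℝ) ^ (d + 1)) ^ lvl x.hN x.D x.hk y)⁻¹)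
                (fun y => (plateau_pos x.toKIdx y).le)) Bq δ12₃ U) ∧
      (∀ (x : MemberY d ℓ hd hL b₀ b₁ Mstar) (U : (bg9YR (Matrix (Fin N) (Fin N) ℂ) (specialUnitaryUnits (Fin N)) R₁ R₂ x).Cfg),
        Letters313DMZ (𝔬12 x) (𝔭A x) (Dd x) 1 (H x) ⟨geo9Y_dist_triangle x, geo9Y_dist_comm x, geo9K_dist_nonneg x.toKIdx, geo9Y_len_pos x⟩
            (fun y => ((((ℓ + 1 : ℕ) : ℝ) ^ (d + 1)) ^ lvl x.hN x.D x.hk y)⁻¹) (fun y => plateau_pos x.toKIdx y) B12₃ Bq12 δ12₃ (bH13 x) U →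
          Letters313DMZ (𝔬12 x) (𝔭A x) (Dd x) 1 (H x) ⟨geo9Y_dist_triangle x, geo9Y_dist_comm x, geo9K_dist_nonneg x.toKIdx, geo9Y_len_pos x⟩
            (fun y => ((((ℓ + 1 : ℕ) : ℝ) ^ (d + 1)) ^ lvl x.hN x.D x.hk y)⁻¹) (fun y => plateau_pos x.toKIdx y) B12₃ Bq δ12₃ (bH13 x) U) := by
  -- [4] (2.61) at rate 1 above ONE threshold, constant floored at 0; the letter `Bq⋆ := max Bq12 (Bh12·e^{(δ12₃+1)(ℓ+4)}·c_Q)` (dag-n06-w5 (c1))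
  obtain ⟨ML, c₁, hrow⟩ := rowSum261_geo9Y (d := d) (ℓ := ℓ) (hd := hd) (hL := hL) (b₀ := b₀) (b₁ := b₁) (Mstar := Mstar) 1 one_pos
  refine ⟨max M₀ ML, fun β => max (Bq12 β) (Bh12 β * Real.exp ((δ12₃ + 1) * ((ℓ : ℝ) + 4)) * max c₁ 0),
    fun β => (hBq12 β).trans (le_max_left _ _), fun x hM α₀ hα ha U hU hU' => ?_, fun x U h => ?_⟩
  · have hrowx : RowSum (toB6 (geo9Y x) 1 (H x)) 1 (max c₁ 0) := fun y => (hrow x ((le_max_right _ _).trans hM) y).trans (le_max_left _ _)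
    -- dag-n06-w5's Y-face consumed UNCHANGED at `ops312RY ∕ holderProbesRY` (`B9OpsRTransport`); G₀-layer input over `thm33G0Dir_iff`, output back over `lettersHHZ_iff`
    have h33' := h33 x ((le_max_left _ _).trans hM) α₀ hα ha U hU hU'
    rw [← thm33G0Dir_iff] at h33'
    -- bridge back with node00-def-Y's `lettersHHZ_iff` (explicit-argument form; `exact` closes the `(ops312RY 𝔬).blkZ = 𝔬.blkZ` defeq inside `bZ`)
    exact (lettersHHZ_iff _ _ _ _ _ _ _ _ _).1 (lettersHHZ_pins x (hβ1 x) (𝔬 := ops312RY (𝔬12 x)) (𝔭 := holderProbesRY (𝔭A x)) (Dd := Dd x) (Dds := Dds x) (hY335 x α₀ U hU) hrowx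
      (le_max_right _ _) hBh12 (δQ := δ12₃ + 1) (by linarith only [hδ12₃]) hδ12₃ hδ₃₀ (by linarith only)
      (fun _ _ _ => le_max_right _ _) (hblk12 x) (hblkZ12 x) (hQsco12 x U) h33' (fun y => (plateau_pos x.toKIdx y).le))
  · exact letters313DMZ_mono _ hB12₃ le_rfl (fun β _ _ => hBq12 β) (fun β _ _ => le_max_left _ _) le_rfl h

end Summit.QuantumFields.YangMills.BalabanUVNodes.N06HHLegAtPinsPhysR

end
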